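import Summits.BirchSwinnertonDyer.BirchSwinnertonDyer.Theorems.Rank2ObservatoryCubicFieldR1427028
import HarnessLib

/-!
# BirchSwinnertonDyer — rank ≥ 2 observatory: class number one of the cubic field of `-57 + 111 * X - 25 * X ^ 2 + X ^ 3` (`Δ = 1427028`) — certificates at the primes 331, 337

HONEST FRAMING: per-curve certified theorems and census instruments; no claim on BSD in rank ≥ 2.

Companion of the per-FIELD file `Rank2ObservatoryCubicFieldR1427028` of the KERNEL-2DESC instrument (design
`b2b-bsdr2-cert-3/KERNEL-2DESC.md` §9e–§9g): the degree-one prime-element certificates at the primes 331, 337 (part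
c). Split off for file size; generated by the same generator from the same checked data.
Sorry-free; axioms `propext`, `Classical.choice`, `Quot.sound`.
[cite: Marcus2018, Ch. 3 Thm. 27, Ch. 5 Cor. 2 of Thm. 37]
-/

-- single-conjunct summit: `Summit.BirchSwinnertonDyer.BirchSwinnertonDyer.…` repeats the name by design
set_option linter.dupNamespace false

noncomputable section

open scoped Classical NumberField

open Literature.NumberTheory.NumberFields Polynomial Module NumberField

namespace Summit.BirchSwinnertonDyer.BirchSwinnertonDyer.Rank2Observatory.TwoDescCubic

namespace FieldR1427028

/-! ## Class number one -/

/-- Certificate at `331`: every ring map `ψ : 𝓞 K → ℤ/331` kills a prime element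
(`α ↦ 85`: `-590 + 147 * α - 6 * α ^ 2` (norm `331`); `α ↦ 120`: `164 - 311 * α + 56 * α ^ 2` (norm `-331`); `α ↦ 151`: `50 - 22 * α + α ^ 2` (norm `-331`)). [cite: Marcus2018, Ch. 3, Thm. 27] -/
theorem cert331 (ψ : 𝓞 (CubicField (-25) 111 (-57)) →+* ZMod 331) : ∃ e : 𝓞 (CubicField (-25) 111 (-57)), ψ e = 0 ∧ Prime e := by
  refine cert_of_cases aeval_α ψ (fun t ht hF => ?_)
  have hroots : ∀ t : ZMod 331,
      t ^ 3 + (((-25) : ℤ) : ZMod 331) * t ^ 2 + ((111 : ℤ) : ZMod 331) * t + (((-57) : ℤ) : ZMod 331) = 0 → t = 85 ∨ t = 120 ∨ t = 151 := by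
    decide +kernel
  rcases hroots t hF with rfl | rfl | rfl
  · exact ⟨lin aeval_α (-590) 147 (-6), by simp only [lin, map_add, map_mul, map_pow, map_intCast, ht]; decide,
      lin_prime_of_prime irreducible aeval_α finrank_eq (-590) 147 (-6) (n := 331)
        (by norm_num [MonicCubic.normForm]) (by norm_num)⟩
  · exact ⟨lin aeval_α 164 (-311) 56, by simp only [lin, map_add, map_mul, map_pow, map_intCast, ht]; decide,
      lin_prime_of_prime irreducible aeval_α finrank_eq 164 (-311) 56 (n := (-331))
        (by norm_num [MonicCubic.normForm]) (by norm_num)⟩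
  · exact ⟨lin aeval_α 50 (-22) 1, by simp only [lin, map_add, map_mul, map_pow, map_intCast, ht]; decide,
      lin_prime_of_prime irreducible aeval_α finrank_eq 50 (-22) 1 (n := (-331))
        (by norm_num [MonicCubic.normForm]) (by norm_num)⟩

/-- Certificate at `337`: `g` has no root mod `337`, so there is no ring map `𝓞 K → ℤ/337`. [folklore] -/
theorem cert337 (ψ : 𝓞 (CubicField (-25) 111 (-57)) →+* ZMod 337) : ∃ e : 𝓞 (CubicField (-25) 111 (-57)), ψ e = 0 ∧ Prime e :=
  cert_of_no_root aeval_α ψ (by decide +kernel)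

end FieldR1427028

end Summit.BirchSwinnertonDyer.BirchSwinnertonDyer.Rank2Observatory.TwoDescCubic

end
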